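import Literature.MathematicalPhysics.QuantumFieldTheory.Balaban1983to89.B5TorusCover
import Literature.MathematicalPhysics.QuantumFieldTheory.King1986.UniformDecay

/-!
# BalabanUVNodes ∕ N15 — THE KING-MODEL RUNG, CURVED EDITION (PART Ω): POWER-LAW LATTICE SUMS ON THE TORUS BY DYADIC SHELLS —
# `Σ_{1 ≤ |y − x| ≤ 2^k} |y − x|^{θ − d} ≤ (3^d + 5^d·Σ_{j<k}(2^θ)^j)` (`0 < θ ≤ d`… only `θ ≤ d` is used), uniformly in the periods
# (the near-field counting input of the Calderón–Zygmund split behind [B9] (3.45) at `U ≡ 1`; the tree has the ball counts `B5TorusCover.ballCard_le`,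
# the EXPONENTIAL sums `torusSum_le`, and — on the B3 carrier `Site P j` with the ℕ-valued `supDist` — `B3TorusRadialSums.radial_sum_le` for INTEGER
# inverse powers WITH an exponential weight; the REAL-exponent, undamped sums on the B4∕King carrier below are new)
# (Track A, DAG node N15 = NE2; FAN-OUT v1.1 §N15 s3 «KING-MODEL RUNG …»)

HONEST FRAMING.  Count-neutral lattice bookkeeping (cell `pub-ymgap`, seat `pub-ymgap-dag-n15-e` g9; `--supports stmt-QuantumFields-20544 --as helper` = K3⁷
`SpineGivenEndpointR13SepCoPH`, WORDS-143).  Folklore geometry of the discrete torus `Π_i ℤ∕N_i` with the sup circular distance `B4Sect5Torus.tdist`: the dyadic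
shell `2^k < |y − x| ≤ 2^{k+1}` has at most `#ball(2^{k+1}) ≤ (2·2^{k+1} + 1)^d ≤ (5·2^k)^d` points (the TREE's `B5TorusCover.ballCard_le`), on it
`|y − x|^{θ−d} ≤ (2^k)^{θ−d}`, so it contributes `≤ 5^d·(2^k)^θ = 5^d(2^θ)^k`; induction on `k`.  The consumer is the near-field sum
`Σ_{|y−x| ≤ 2ρ} |y − x|^{γ−(d+1)}·… ≲ ρ^γ` of the Hölder norm (3.45) of `∇G∇*λ` (King's (3.65) `|a| = |b| = 1` kernels, parts Y∕Z).  Nothing here is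
specific to King's propagators; NOT a node discharge; nothing continuum ∕ ℝ⁴ ∕ OS ∕ mass-gap ∕ Clay.  0 `sorry`, 0 `def`, standard axioms.
* `tdist_rpow_shell_le` (one dyadic shell), ★ `powerSum_dyadic_le` (the induction), ★ `powerSum_dyadic_le_pow` (closed form `≤ (3^d + 5^d·2^θ∕(2^θ − 1))·(2^k)^θ`, `θ > 0`),
  `powerSum_dyadic_le_pow_tdistT` (the same on King's `Tor K` with `King1986.Torus.tdistT`, transported through `toSite`).
Locators: [Balaban1985BackgroundPropagators] Thm 3.1 (3.45) p. 398 (consumer); [King1986] Prop. 3.7 (3.65) p. 663 (the power-law kernels it is paired with).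
-/

namespace Summit.QuantumFields.YangMills.BalabanUVNodes.N15KingModelRung.Curved

open Finset
open Literature.MathematicalPhysics.QuantumFieldTheory.Balaban1983to89.B4Sect5Torus (TSite tdist tdist_nonneg)
open Literature.MathematicalPhysics.QuantumFieldTheory.Balaban1983to89.B5TorusCover (ballCard_le)
open Literature.MathematicalPhysics.QuantumFieldTheory.Balaban1983to89.B5Prop11Plancherel (Tor)
open Literature.MathematicalPhysics.QuantumFieldTheory.King1986.Torus (tdistT toSite toSite_injective one_le_period)

variable {dd : ℕ} {N : Fin dd → ℕ}

/-- **One dyadic shell**: `Σ_{2^k < |y−x| ≤ 2^{k+1}} |y − x|^{θ−d} ≤ 5^d·(2^θ)^k` for `θ ≤ d` — at most `(2·2^{k+1}+1)^d ≤ (5·2^k)^d` points (the tree's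
`ballCard_le`), each weighing `≤ (2^k)^{θ−d}`. [folklore] -/
theorem tdist_rpow_shell_le (hN : ∀ i, 1 ≤ N i) (x : TSite dd N) {θ : ℝ} (hθ : θ ≤ dd) (k : ℕ) :
    ∑ y ∈ Finset.univ.filter (fun y : TSite dd N => (2 : ℝ) ^ k < tdist N x y ∧ tdist N x y ≤ (2 : ℝ) ^ (k + 1)),
        tdist N x y ^ (θ - dd) ≤ (5 : ℝ) ^ dd * ((2 : ℝ) ^ θ) ^ k := by
  have h2k : (0 : ℝ) < (2 : ℝ) ^ k := by positivity
  -- each term ≤ (2^k)^(θ−d)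
  have hterm : ∀ y ∈ Finset.univ.filter (fun y : TSite dd N => (2 : ℝ) ^ k < tdist N x y ∧ tdist N x y ≤ (2 : ℝ) ^ (k + 1)),
      tdist N x y ^ (θ - dd) ≤ ((2 : ℝ) ^ k) ^ (θ - dd) := by
    intro y hy
    have hlt := (Finset.mem_filter.mp hy).2.1
    exact Real.rpow_le_rpow_of_nonpos h2k hlt.le (by linarith)
  -- the count
  have hcard : ((Finset.univ.filter (fun y : TSite dd N => (2 : ℝ) ^ k < tdist N x y ∧ tdist N x y ≤ (2 : ℝ) ^ (k + 1))).card : ℝ)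
      ≤ ((5 : ℝ) * (2 : ℝ) ^ k) ^ dd := by
    have hsub : Finset.univ.filter (fun y : TSite dd N => (2 : ℝ) ^ k < tdist N x y ∧ tdist N x y ≤ (2 : ℝ) ^ (k + 1))
        ⊆ Finset.univ.filter (fun y : TSite dd N => tdist N x y ≤ (2 : ℝ) ^ (k + 1)) := by
      intro y hy
      rw [Finset.mem_filter] at hy ⊢
      exact ⟨hy.1, hy.2.2⟩
    have hb := ballCard_le hN x (r := (2 : ℝ) ^ (k + 1)) (by positivity)
    have hfloor : ⌊(2 : ℝ) ^ (k + 1)⌋₊ = 2 ^ (k + 1) := by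
      rw [show (2 : ℝ) ^ (k + 1) = ((2 ^ (k + 1) : ℕ) : ℝ) by push_cast; ring, Nat.floor_natCast]
    rw [hfloor] at hb
    have h1 : ((Finset.univ.filter (fun y : TSite dd N => (2 : ℝ) ^ k < tdist N x y ∧ tdist N x y ≤ (2 : ℝ) ^ (k + 1))).card : ℝ)
        ≤ ((2 * 2 ^ (k + 1) + 1 : ℕ) : ℝ) ^ dd := by
      exact_mod_cast (Finset.card_le_card hsub).trans hb
    refine h1.trans (pow_le_pow_left₀ (by positivity) ?_ dd)
    push_cast
    rw [pow_succ]
    have : (1 : ℝ) ≤ (2 : ℝ) ^ k := one_le_pow₀ (by norm_num)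
    linarith
  -- assemble: sum ≤ card • bound
  have hsum := Finset.sum_le_card_nsmul _ _ _ hterm
  rw [nsmul_eq_mul] at hsum
  refine hsum.trans ?_
  have hpow : ((5 : ℝ) * (2 : ℝ) ^ k) ^ dd * ((2 : ℝ) ^ k) ^ (θ - dd) = (5 : ℝ) ^ dd * ((2 : ℝ) ^ θ) ^ k := by
    rw [mul_pow, mul_assoc, ← Real.rpow_natCast ((2 : ℝ) ^ k) dd, ← Real.rpow_add h2k, add_sub_cancel,
      ← Real.rpow_natCast (2 : ℝ) k, ← Real.rpow_mul (by norm_num), mul_comm (k : ℝ) θ, Real.rpow_mul (by norm_num),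
      Real.rpow_natCast]
  calc ((Finset.univ.filter (fun y : TSite dd N => (2 : ℝ) ^ k < tdist N x y ∧ tdist N x y ≤ (2 : ℝ) ^ (k + 1))).card : ℝ)
        * ((2 : ℝ) ^ k) ^ (θ - dd)
      ≤ ((5 : ℝ) * (2 : ℝ) ^ k) ^ dd * ((2 : ℝ) ^ k) ^ (θ - dd) :=
        mul_le_mul_of_nonneg_right hcard (Real.rpow_nonneg h2k.le _)
    _ = (5 : ℝ) ^ dd * ((2 : ℝ) ^ θ) ^ k := hpow

/-- **POWER-LAW LATTICE SUMS BY DYADIC SHELLS**: for every period vector (all `N_i ≥ 1`), centre `x`, exponent `θ ≤ d` and `k : ℕ`,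
`Σ_{1 ≤ |y−x| ≤ 2^k} |y − x|^{θ−d} ≤ 3^d + 5^d·Σ_{j<k}(2^θ)^j` — uniformly in the periods. [folklore] -/
theorem powerSum_dyadic_le (hN : ∀ i, 1 ≤ N i) (x : TSite dd N) {θ : ℝ} (hθ : θ ≤ dd) (k : ℕ) :
    ∑ y ∈ Finset.univ.filter (fun y : TSite dd N => 1 ≤ tdist N x y ∧ tdist N x y ≤ (2 : ℝ) ^ k), tdist N x y ^ (θ - dd)
      ≤ (3 : ℝ) ^ dd + (5 : ℝ) ^ dd * ∑ j ∈ Finset.range k, ((2 : ℝ) ^ θ) ^ j := by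
  induction k with
  | zero =>
    rw [Finset.sum_range_zero, mul_zero, add_zero, pow_zero]
    -- `|y − x| = 1`: each term is `1^(θ−d) = 1`... `≤ 1`, and there are `≤ 3^d` such points
    have hterm : ∀ y ∈ Finset.univ.filter (fun y : TSite dd N => 1 ≤ tdist N x y ∧ tdist N x y ≤ (1 : ℝ)),
        tdist N x y ^ (θ - dd) ≤ (1 : ℝ) := by
      intro y hy
      have h1 := (Finset.mem_filter.mp hy).2.1
      exact Real.rpow_le_one_of_one_le_of_nonpos h1 (by linarith)
    have hsum := Finset.sum_le_card_nsmul _ _ _ hterm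
    rw [nsmul_eq_mul, mul_one] at hsum
    refine hsum.trans ?_
    have hsub : Finset.univ.filter (fun y : TSite dd N => 1 ≤ tdist N x y ∧ tdist N x y ≤ (1 : ℝ))
        ⊆ Finset.univ.filter (fun y : TSite dd N => tdist N x y ≤ (1 : ℝ)) := by
      intro y hy
      rw [Finset.mem_filter] at hy ⊢
      exact ⟨hy.1, hy.2.2⟩
    have hb := ballCard_le hN x (r := (1 : ℝ)) zero_le_one
    rw [Nat.floor_one] at hb
    have h1 : ((Finset.univ.filter (fun y : TSite dd N => 1 ≤ tdist N x y ∧ tdist N x y ≤ (1 : ℝ))).card : ℝ)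
        ≤ ((2 * 1 + 1 : ℕ) : ℝ) ^ dd := by
      exact_mod_cast (Finset.card_le_card hsub).trans hb
    refine h1.trans (le_of_eq ?_)
    norm_num
  | succ k IH =>
    -- split the range `1 ≤ r ≤ 2^{k+1}` at `2^k`
    have hsplit := Finset.sum_filter_add_sum_filter_not
      (Finset.univ.filter (fun y : TSite dd N => 1 ≤ tdist N x y ∧ tdist N x y ≤ (2 : ℝ) ^ (k + 1)))
      (fun y : TSite dd N => tdist N x y ≤ (2 : ℝ) ^ k) (fun y => tdist N x y ^ (θ - dd))
    have hkk : (2 : ℝ) ^ k ≤ (2 : ℝ) ^ (k + 1) := pow_le_pow_right₀ (by norm_num) (Nat.le_succ k)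
    have hlow : (Finset.univ.filter (fun y : TSite dd N => 1 ≤ tdist N x y ∧ tdist N x y ≤ (2 : ℝ) ^ (k + 1))).filter
          (fun y : TSite dd N => tdist N x y ≤ (2 : ℝ) ^ k)
        = Finset.univ.filter (fun y : TSite dd N => 1 ≤ tdist N x y ∧ tdist N x y ≤ (2 : ℝ) ^ k) := by
      rw [Finset.filter_filter]
      refine Finset.filter_congr fun y _ => ⟨fun h => ⟨h.1.1, h.2⟩, fun h => ⟨⟨h.1, h.2.trans hkk⟩, h.2⟩⟩
    have hhigh : (Finset.univ.filter (fun y : TSite dd N => 1 ≤ tdist N x y ∧ tdist N x y ≤ (2 : ℝ) ^ (k + 1))).filter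
          (fun y : TSite dd N => ¬ tdist N x y ≤ (2 : ℝ) ^ k)
        = Finset.univ.filter (fun y : TSite dd N => (2 : ℝ) ^ k < tdist N x y ∧ tdist N x y ≤ (2 : ℝ) ^ (k + 1)) := by
      rw [Finset.filter_filter]
      refine Finset.filter_congr fun y _ => ⟨fun h => ⟨not_le.mp h.2, h.1.2⟩, fun h => ⟨⟨?_, h.2⟩, not_le.mpr h.1⟩⟩
      have : (1 : ℝ) ≤ (2 : ℝ) ^ k := one_le_pow₀ (by norm_num)
      linarith [h.1]
    rw [← hsplit, hlow, hhigh, Finset.sum_range_succ, mul_add, ← add_assoc]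
    exact add_le_add IH (tdist_rpow_shell_le hN x hθ k)

/-- **THE CLOSED FORM** (`0 < θ ≤ d`): `Σ_{1 ≤ |y−x| ≤ 2^k} |y − x|^{θ−d} ≤ (3^d + 5^d·2^θ∕(2^θ − 1))·(2^k)^θ` — the power-law growth `R^θ` of the
near-field sums, uniformly in the periods. [folklore] -/
theorem powerSum_dyadic_le_pow (hN : ∀ i, 1 ≤ N i) (x : TSite dd N) {θ : ℝ} (hθ0 : 0 < θ) (hθ : θ ≤ dd) (k : ℕ) :
    ∑ y ∈ Finset.univ.filter (fun y : TSite dd N => 1 ≤ tdist N x y ∧ tdist N x y ≤ (2 : ℝ) ^ k), tdist N x y ^ (θ - dd)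
      ≤ ((3 : ℝ) ^ dd + (5 : ℝ) ^ dd * ((2 : ℝ) ^ θ / ((2 : ℝ) ^ θ - 1))) * ((2 : ℝ) ^ k) ^ θ := by
  set q : ℝ := (2 : ℝ) ^ θ with hq
  have hq1 : 1 < q := Real.one_lt_rpow (by norm_num) hθ0
  have hq0 : 0 < q := by linarith
  have hqk : ((2 : ℝ) ^ k) ^ θ = q ^ k := by
    rw [hq, ← Real.rpow_natCast (2 : ℝ) k, ← Real.rpow_mul (by norm_num), mul_comm (k : ℝ) θ, Real.rpow_mul (by norm_num),
      Real.rpow_natCast]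
  have hqk1 : 1 ≤ q ^ k := one_le_pow₀ hq1.le
  -- the geometric sum with ratio `q > 1`
  have hgeom : ∑ j ∈ Finset.range k, q ^ j ≤ q ^ k / (q - 1) := by
    rw [geom_sum_eq hq1.ne' k]
    exact div_le_div_of_nonneg_right (by linarith) (by linarith)
  have h := powerSum_dyadic_le hN x hθ k
  rw [hqk]
  calc _ ≤ (3 : ℝ) ^ dd + (5 : ℝ) ^ dd * ∑ j ∈ Finset.range k, q ^ j := h
    _ ≤ (3 : ℝ) ^ dd * q ^ k + (5 : ℝ) ^ dd * (q ^ k / (q - 1)) := by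
        have h3 : (3 : ℝ) ^ dd ≤ (3 : ℝ) ^ dd * q ^ k := le_mul_of_one_le_right (by positivity) hqk1
        have h5 := mul_le_mul_of_nonneg_left hgeom (by positivity : (0 : ℝ) ≤ (5 : ℝ) ^ dd)
        linarith
    _ ≤ ((3 : ℝ) ^ dd + (5 : ℝ) ^ dd * (q / (q - 1))) * q ^ k := by
        have hsub : 0 < q - 1 := by linarith
        have e : (5 : ℝ) ^ dd * (q ^ k / (q - 1)) ≤ (5 : ℝ) ^ dd * (q / (q - 1)) * q ^ k := by
          rw [mul_assoc, div_mul_eq_mul_div]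
          refine mul_le_mul_of_nonneg_left (div_le_div_of_nonneg_right ?_ hsub.le) (by positivity)
          exact le_mul_of_one_le_left (by positivity) hq1.le
        nlinarith

/-- **The same on King's tori** (`Tor K = Π_μ ZMod (K μ)` with `King1986.Torus.tdistT = tdist ∘ toSite`): for `0 < θ ≤ d` and every `k`,
`Σ_{y : 1 ≤ tdistT x y ≤ 2^k} tdistT(x, y)^{θ−d} ≤ (3^d + 5^d·2^θ∕(2^θ − 1))·(2^k)^θ` — transported through the injection `toSite`. [folklore] -/
theorem powerSum_dyadic_le_pow_tdistT {dd : ℕ} (K : Fin dd → ℕ) [∀ μ, NeZero (K μ)] (x : Tor K) {θ : ℝ} (hθ0 : 0 < θ)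
    (hθ : θ ≤ dd) (k : ℕ) :
    ∑ y ∈ Finset.univ.filter (fun y : Tor K => 1 ≤ tdistT K x y ∧ tdistT K x y ≤ (2 : ℝ) ^ k), tdistT K x y ^ (θ - dd)
      ≤ ((3 : ℝ) ^ dd + (5 : ℝ) ^ dd * ((2 : ℝ) ^ θ / ((2 : ℝ) ^ θ - 1))) * ((2 : ℝ) ^ k) ^ θ := by
  classical
  have h := powerSum_dyadic_le_pow (one_le_period K) (toSite K x) hθ0 hθ k
  refine le_trans ?_ h
  -- the sum over `Tor K` is the sum over the image of the filtered set under `toSite`, a subset of the filtered `TSite` set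
  have himg : ∑ y ∈ Finset.univ.filter (fun y : Tor K => 1 ≤ tdistT K x y ∧ tdistT K x y ≤ (2 : ℝ) ^ k), tdistT K x y ^ (θ - dd)
      = ∑ w ∈ (Finset.univ.filter (fun y : Tor K => 1 ≤ tdistT K x y ∧ tdistT K x y ≤ (2 : ℝ) ^ k)).image (toSite K),
          tdist K (toSite K x) w ^ (θ - dd) := by
    rw [Finset.sum_image (fun a _ b _ hab => toSite_injective K hab)]
    rfl
  rw [himg]
  refine Finset.sum_le_sum_of_subset_of_nonneg ?_ (fun w _ _ => Real.rpow_nonneg (tdist_nonneg K _ w) _)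
  intro w hw
  rw [Finset.mem_image] at hw
  obtain ⟨y, hy, rfl⟩ := hw
  rw [Finset.mem_filter] at hy ⊢
  exact ⟨Finset.mem_univ _, hy.2⟩

end Summit.QuantumFields.YangMills.BalabanUVNodes.N15KingModelRung.Curved
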